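import Mathlib
import HarnessLib
import Summits.Ventures.LatticeQCDFlow.Scaling.AutoregressiveGaugeHeatBathAnyDim
import Summits.Ventures.LatticeQCDFlow.Scaling.PlaquettePeelingClosingBound
import Summits.Ventures.LatticeQCDFlow.Scoring.IndepMHRejectionFloor

/-!
# LatticeQCDFlow / Scaling — THE FLOOR: the exact one-plaquette heat-bath sampler with a closing section of
# size `s` has an observable with `τ_int ≥ 1/(π(A) + (M₂/M)^s/θ) − 1/2`; acceptance at the cold
# configuration is at most `(M₂/M)^s`

HONEST FRAMING: exact (Metropolis-corrected) sampling algorithms for lattice gauge theory;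
figures of merit are autocorrelation/cost numbers at stated couplings and volumes; no
continuum-physics claim.

Venture `LatticeQCDFlow` (cell pub-lqcd), topic `Scaling`, FANOUT row 30 (lean-1, GEN-26) — OUR WORK on
THEORY-2.md §4 row C5, the LOWER half of the volume law.  GEN-24's scorecard
(`Scaling/AutoregressiveGaugeHeatBathAnyDim`) proved, for the exact independence Metropolis sampler with
the block proposal `q_B = (F_B/Z_B)·Haar^{⊗E}` of ANY plaquette set `B` of `(ℤ/L)^d` (`w` continuous,
`0 < m ≤ w ≤ M`, `k = #Bᶜ`), the CEILING `τ_int(f) ≤ (M/m)^k − 1/2` for every bounded observable and the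
pointwise acceptance floor `(m/M)^k`.  Here is the matching FLOOR, from the peeling bound
`Z/Z_B ≤ M^{k−s} M₂^{s}` of `Scaling/PlaquettePeelingClosingBound` (`(B, t, rank)` ranked with a closing
section `(S, u)` of size `s`; `M₂` the two-plaquette constant, `∫ w(h) w(a h^{±1} b) dHaar ≤ c·M₂`) and the
tree's kernel-level rejection floor `Scoring.indepMH_tauInt_ge_rejection` (row 8 over row 2's positivity):

* §1 (general state space; `K = indepMH q w`, `π = w·q`, `∫ w dq = 1`) **`indepMH_event_tauInt_ge`** —
  for every event `A` with `π(A) > 0` on which the acceptance mass is `≤ η`, the centred indicator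
  `g = 1_A − π(A)` has `τ_int(g) ≥ 1/(π(A) + η) − 1/2` (its `g²`-weighted rejection rate is
  `≥ (1 − π(A))(1 − η)`); with `imhAcceptMass_le` (`A(x) ≤ 1/w(x)`): **an exact independence sampler is
  slow wherever its importance weight is large** — `τ_int(1_A) ≥ 1/(π(A) + 1/inf_A w) − 1/2`;
* §2 (the lattice; `w(1) = M`, so the cold configuration `U ≡ 1` has `F_R = M^k`)
  **`closing_densityRatio_le`** — the model-to-target ratio `ρ = Z/(Z_B F_R)` obeys
  `ρ(U) ≤ (M₂/M)^s · M^k/F_R(U)`, `= (M₂/M)^s` at the cold configuration;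
  **`closing_imhAcceptMass_le`** — the sampler's acceptance mass from `U` is `≤ ρ(U)`, so from any
  configuration with `F_R > θ M^k` it is `≤ (M₂/M)^s/θ`: THE COLD START FREEZES for `≳ (M/M₂)^s` steps;
  **`closing_event_tauInt_ge`** — for every measurable `A ⊆ {F_R > θ M^k}` with `π(A) > 0`:
  `τ_int(1_A − π(A)) ≥ 1/(π(A) + (M₂/M)^s/θ) − 1/2`.

With `Scaling/TorusClosingSection` (`s ≥ k/(2d−3)` for the optimal structures, `k = k_min(d, L) =
(d−1)(d−2)/2·L^d + (d−1)`) this is a floor of order `(M/M₂)^{k_min/(2d−3)}` — EXPONENTIAL IN THE VOLUME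
in every `d ≥ 3` as soon as `M₂ < M` (every non-constant weight), against the ceiling `(M/m)^{k_min} − 1/2`;
in `d = 2` (`k = s = 1`) both sides are volume-independent.  The sequel makes `π(A)` small (`θ ↑ 1`,
`Haar{w = M} = 0`).  NOT CLAIMED: that smooth observables (the plaquette) are slow in stationarity — the
slow observable lives at the cold configuration, which the target rarely visits; any value of `M₂`.
No `def`, no `sorry`, nothing cited as a fact.
-/

noncomputable section

open MeasureTheory ProbabilityTheory Function Finset
open scoped ENNReal

/-! ## §1 An exact independence sampler is slow wherever its importance weight is large -/

namespace Summit.Ventures.LatticeQCDFlow.Scoring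

open Summit.Ventures.LatticeQCDFlow.Exactness

variable {Ω : Type*} [MeasurableSpace Ω] {q π : Measure Ω} [IsProbabilityMeasure q]
  [IsProbabilityMeasure π] {w : Ω → ℝ}

/-- **`τ_int(1_A − π(A)) ≥ 1/(π(A) + η) − 1/2`** for the flow-MCMC kernel `K = indepMH q w` with target
`π = w·q`: `A` any event of positive target probability on which the acceptance mass is at most `η ≥ 0`,
the centred indicator's autocorrelation summable.  The `g²`-weighted rejection rate of
`g = 1_A − π(A)` is at least `(1 − π(A))(1 − η)`, and row 8's floor `τ_int ≥ (1 + r_g)/(2(1 − r_g))` is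
monotone. [ours] -/
theorem indepMH_event_tauInt_ge (hw : Measurable w) (hw0 : ∀ x, 0 < w x) (hwi : Integrable w q)
    (hπ : (q.withDensity fun x => ENNReal.ofReal (w x)) = π) {A : Set Ω} (hA : MeasurableSet A)
    {η : ℝ} (hη0 : 0 ≤ η) (hηA : ∀ x ∈ A, (imhAcceptMass q w x).toReal ≤ η) (hpos : 0 < π.real A)
    (hs : Summable fun t => autocov (indepMH q w) π (fun x => A.indicator (fun _ => (1 : ℝ)) x - π.real A) (t + 1) /
      autocov (indepMH q w) π (fun x => A.indicator (fun _ => (1 : ℝ)) x - π.real A) 0) :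
    1 / (π.real A + η) - 1 / 2 ≤
      tauInt (fun t => autocov (indepMH q w) π (fun x => A.indicator (fun _ => (1 : ℝ)) x - π.real A) t /
        autocov (indepMH q w) π (fun x => A.indicator (fun _ => (1 : ℝ)) x - π.real A) 0) := by
  set p : ℝ := π.real A with hp
  set g : Ω → ℝ := fun x => A.indicator (fun _ => (1 : ℝ)) x - p with hg
  have hp1 : p ≤ 1 := by rw [hp]; exact measureReal_le_one
  have hgm : Measurable g := (measurable_const.indicator hA).sub measurable_const
  have hgb : ∀ x, |g x| ≤ 1 := by
    intro x
    by_cases hx : x ∈ A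
    · simp only [hg, Set.indicator_of_mem hx]
      rw [abs_le]; constructor <;> linarith [hpos.le, hp1]
    · simp only [hg, Set.indicator_of_notMem hx]
      rw [abs_le]; constructor <;> linarith [hpos.le, hp1]
  have hfloor := indepMH_tauInt_ge_rejection hw hw0 hwi hπ hgm hgb hs
  -- the ingredients: `C₀ = p(1 − p)` and `∫ g²(1 − A) dπ ≥ p (1 − p)² (1 − η')`, `η' = min η 1`
  set η' : ℝ := min η 1 with hη'
  have hη'0 : 0 ≤ η' := le_min hη0 zero_le_one
  have hη'1 : η' ≤ 1 := min_le_right _ _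
  have hacc1 : ∀ x, (imhAcceptMass q w x).toReal ≤ 1 := fun x => by
    simpa using ENNReal.toReal_mono ENNReal.one_ne_top (imhAcceptMass_le_one q w x)
  have hη'A : ∀ x ∈ A, (imhAcceptMass q w x).toReal ≤ η' := fun x hx => le_min (hηA x hx) (hacc1 x)
  have hind : ∫ x, A.indicator (fun _ => (1 : ℝ)) x ∂π = p := by
    rw [integral_indicator_const (1 : ℝ) hA, smul_eq_mul, mul_one, hp]
  have hC0 : autocov (indepMH q w) π g 0 = p * (1 - p) := by
    rw [autocov_zero]
    have e : ∀ x, g x ^ 2 = (1 - 2 * p) * A.indicator (fun _ => (1 : ℝ)) x + p ^ 2 := by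
      intro x
      by_cases hx : x ∈ A
      · simp only [hg, Set.indicator_of_mem hx]; ring
      · simp only [hg, Set.indicator_of_notMem hx]; ring
    simp_rw [e]
    rw [integral_add ((integrable_const _).indicator hA |>.const_mul _) (integrable_const _),
      integral_const_mul, hind, integral_const, smul_eq_mul, probReal_univ, one_mul]
    ring
  have hN : p * ((1 - p) ^ 2 * (1 - η')) ≤ ∫ x, g x ^ 2 * (1 - (imhAcceptMass q w x).toReal) ∂π := by
    have hle : ∀ x, (1 - p) ^ 2 * (1 - η') * A.indicator (fun _ => (1 : ℝ)) x ≤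
        g x ^ 2 * (1 - (imhAcceptMass q w x).toReal) := by
      intro x
      by_cases hx : x ∈ A
      · simp only [hg, Set.indicator_of_mem hx, mul_one]
        exact mul_le_mul_of_nonneg_left (by linarith [hη'A x hx]) (sq_nonneg _)
      · simp only [Set.indicator_of_notMem hx, mul_zero]
        exact mul_nonneg (sq_nonneg _) (by linarith [hacc1 x])
    have hmeas : Measurable fun x => (imhAcceptMass q w x).toReal :=
      (measurable_imhAcceptMass q hw).ennreal_toReal
    have hint : Integrable (fun x => g x ^ 2 * (1 - (imhAcceptMass q w x).toReal)) π := by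
      refine Integrable.mono' (integrable_const (1 : ℝ)) ((hgm.pow_const 2).mul
        (measurable_const.sub hmeas)).aestronglyMeasurable (ae_of_all _ fun x => ?_)
      rw [Real.norm_eq_abs, abs_mul, abs_of_nonneg (sq_nonneg _),
        abs_of_nonneg (by linarith [hacc1 x])]
      have h1 : g x ^ 2 ≤ 1 := by
        have := hgb x; rw [abs_le] at this; nlinarith
      have h2 : 1 - (imhAcceptMass q w x).toReal ≤ 1 := by linarith [ENNReal.toReal_nonneg (a := imhAcceptMass q w x)]
      calc g x ^ 2 * (1 - (imhAcceptMass q w x).toReal) ≤ 1 * 1 :=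
            mul_le_mul h1 h2 (by linarith [hacc1 x]) zero_le_one
        _ = 1 := one_mul _
    calc p * ((1 - p) ^ 2 * (1 - η')) = ∫ x, (1 - p) ^ 2 * (1 - η') * A.indicator (fun _ => (1 : ℝ)) x ∂π := by
          rw [integral_const_mul, hind]; ring
      _ ≤ ∫ x, g x ^ 2 * (1 - (imhAcceptMass q w x).toReal) ∂π :=
          integral_mono (((integrable_const _).indicator hA).const_mul _) hint hle
  -- the weighted rejection rate `r ≥ r₀ = (1 − p)(1 − η')`, and `r < 1`
  set r : ℝ := (∫ x, g x ^ 2 * (1 - (imhAcceptMass q w x).toReal) ∂π) / autocov (indepMH q w) π g 0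
    with hr
  set r₀ : ℝ := (1 - p) * (1 - η') with hr₀
  have hr₀r : r₀ ≤ r := by
    rw [hr, hC0]
    rcases hp1.eq_or_lt with h1 | h1
    · rw [hr₀, h1]; simp
    · rw [le_div_iff₀ (mul_pos hpos (by linarith)), hr₀]
      calc (1 - p) * (1 - η') * (p * (1 - p)) = p * ((1 - p) ^ 2 * (1 - η')) := by ring
        _ ≤ _ := hN
  have hr1 : r < 1 := by
    obtain ⟨hρ1, -⟩ := indepMH_tauInt_floor hw hw0 hwi hπ hgm hgb hs
    have hrle : r ≤ autocov (indepMH q w) π g 1 / autocov (indepMH q w) π g 0 := by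
      have h0 : 0 ≤ autocov (indepMH q w) π g 0 := by rw [hC0]; exact mul_nonneg hpos.le (by linarith)
      rcases h0.eq_or_lt with hz | hz
      · rw [hr, ← hz, div_zero, div_zero]
      · exact div_le_div_of_nonneg_right (indepMH_rejection_le_autocov_one hw hw0 hwi hπ hgm hgb) hz.le
    exact lt_of_le_of_lt hrle hρ1
  -- `1/(p + η) − 1/2 ≤ (1 + r₀)/(2(1 − r₀)) ≤ (1 + r)/(2(1 − r)) ≤ τ_int`
  have hkey : 1 / (p + η) - 1 / 2 ≤ (1 + r₀) / (2 * (1 - r₀)) := by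
    have h1r₀ : 0 < 1 - r₀ := by
      rw [hr₀]; nlinarith [hpos, hp1, hη'0, hη'1]
    have hle : 1 - r₀ ≤ p + η' := by rw [hr₀]; nlinarith [hpos.le, hη'0]
    have hη'le : η' ≤ η := min_le_left _ _
    have e : (1 + r₀) / (2 * (1 - r₀)) = 1 / (1 - r₀) - 1 / 2 := by
      field_simp
      ring
    rw [e]
    have : 1 / (p + η) ≤ 1 / (1 - r₀) :=
      one_div_le_one_div_of_le h1r₀ (hle.trans (by linarith))
    linarith
  exact hkey.trans ((geomTauInt_mono hr₀r hr1).trans hfloor)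

end Summit.Ventures.LatticeQCDFlow.Scoring

/-! ## §2 The lattice: cold-start freezing and the `τ_int` floor of the heat-bath block sampler -/

namespace Summit.Ventures.LatticeQCDFlow.Theory2.Autoregressive

open Summit.Ventures.LatticeQCDFlow.Exactness Summit.Ventures.LatticeQCDFlow.Scoring
open Literature.MathematicalPhysics.QuantumFieldTheory Literature.MathematicalPhysics.QuantumLattice

variable {d L : ℕ} [NeZero L] {G : Type*} [Group G] [TopologicalSpace G] [IsTopologicalGroup G]
  [CompactSpace G] [SecondCountableTopology G] [MeasurableSpace G] [BorelSpace G]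

omit [NeZero L] [TopologicalSpace G] [IsTopologicalGroup G] [CompactSpace G] [SecondCountableTopology G]
  [MeasurableSpace G] [BorelSpace G] in
/-- At the cold configuration `U ≡ 1` every plaquette holonomy is `1`, so a product of plaquette weights
over any set `T` is `w(1)^{#T}`. [ours] -/
theorem prod_plaquetteWeight_cold (w : G → ℝ) (T : Finset (Plaquette d L)) :
    ∏ p ∈ T, w (plaquetteHolonomy (fun _ : Edge d L => (1 : G)) p.1 p.2.1.1 p.2.1.2) = w 1 ^ T.card := by
  simp [plaquetteHolonomy]

/-- **THE FLOOR OF THE HEAT-BATH BLOCK SAMPLER WITH A CLOSING SECTION.**  `L ≥ 2`; `w` continuous,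
`0 < m ≤ w ≤ M`; `∫ w(h) w(a h^{±1} b) dHaar ≤ c·M₂` for all `a, b` (`c = ∫ w dHaar`); `(B, t, rank)` ranked
with a closing section `(S, u)` (`Scaling/PlaquettePeelingClosingBound`), `k = #Bᶜ`, `s = #S`;
`π = (F/Z)·Haar^{⊗E}` the target, `q = (F_B/Z_B)·Haar^{⊗E}` the block proposal (the law of the exact
one-plaquette heat-bath autoregressive sampler along a compatible order), `K = indepMH q (Z_B F_R/Z)` the
exact sampler of GEN-24's scorecard (`F_R = ∏_{p∉B} w(U_p)`).  Then
(a) the acceptance mass from EVERY configuration `U` is `≤ (M₂/M)^s · M^k/F_R(U)`;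
(b) for every `θ > 0` and every event `A ⊆ {F_R > θ M^k}` of positive target probability,
`τ_int(1_A − π(A)) ≥ 1/(π(A) + (M₂/M)^s/θ) − 1/2`. [ours] -/
theorem closing_volumeFloor (hL : 2 ≤ L) {w : G → ℝ} (hw : Continuous w) {m M : ℝ} (hm0 : 0 < m)
    (hm : ∀ g, m ≤ w g) (hM : ∀ g, w g ≤ M) {M₂ : ℝ}
    (hM₂ : ∀ a b : G, ∫ h, w h * w (a * h * b) ∂(haarProbability G) ≤
      (∫ g, w g ∂(haarProbability G)) * M₂)
    (hM₂' : ∀ a b : G, ∫ h, w h * w (a * h⁻¹ * b) ∂(haarProbability G) ≤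
      (∫ g, w g ∂(haarProbability G)) * M₂)
    (B : Finset (Plaquette d L)) (t : Plaquette d L → Edge d L)
    (ht : ∀ p ∈ B, t p ∈ ({(p.1, p.2.1.1), (p.1.shift p.2.1.1, p.2.1.2),
        (p.1.shift p.2.1.2, p.2.1.1), (p.1, p.2.1.2)} : Finset (Edge d L)))
    (rank : Plaquette d L → ℕ)
    (hrank : ∀ p ∈ B, ∀ p' ∈ B, p ≠ p' → t p ∈ ({(p'.1, p'.2.1.1), (p'.1.shift p'.2.1.1, p'.2.1.2),
        (p'.1.shift p'.2.1.2, p'.2.1.1), (p'.1, p'.2.1.2)} : Finset (Edge d L)) → rank p < rank p')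
    (S : Finset (Plaquette d L)) (u : Plaquette d L → Plaquette d L) (hSB : ∀ p' ∈ S, p' ∉ B)
    (huB : ∀ p' ∈ S, u p' ∈ B)
    (hut : ∀ p' ∈ S, t (u p') ∈ ({(p'.1, p'.2.1.1), (p'.1.shift p'.2.1.1, p'.2.1.2),
        (p'.1.shift p'.2.1.2, p'.2.1.1), (p'.1, p'.2.1.2)} : Finset (Edge d L)))
    (humax : ∀ p' ∈ S, ∀ p ∈ B, p ≠ u p' → t p ∈ ({(p'.1, p'.2.1.1), (p'.1.shift p'.2.1.1, p'.2.1.2),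
        (p'.1.shift p'.2.1.2, p'.2.1.1), (p'.1, p'.2.1.2)} : Finset (Edge d L)) → rank p < rank (u p'))
    (huinj : Set.InjOn u S)
    (π q : Measure (GaugeConfig d L G)) [IsProbabilityMeasure π] [IsProbabilityMeasure q]
    (hπ : π = (Measure.pi fun _ : Edge d L => haarProbability G).withDensity fun U =>
      ENNReal.ofReal ((∏ p : Plaquette d L, w (plaquetteHolonomy U p.1 p.2.1.1 p.2.1.2)) /
        ∫ V, ∏ p : Plaquette d L, w (plaquetteHolonomy V p.1 p.2.1.1 p.2.1.2)
          ∂(Measure.pi fun _ : Edge d L => haarProbability G)))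
    (hq : q = (Measure.pi fun _ : Edge d L => haarProbability G).withDensity fun U =>
      ENNReal.ofReal ((∏ p ∈ B, w (plaquetteHolonomy U p.1 p.2.1.1 p.2.1.2)) /
        ∫ V, ∏ p ∈ B, w (plaquetteHolonomy V p.1 p.2.1.1 p.2.1.2)
          ∂(Measure.pi fun _ : Edge d L => haarProbability G))) :
    (∀ U : GaugeConfig d L G,
      (imhAcceptMass q (fun U =>
        ((∫ V, ∏ p : Plaquette d L, w (plaquetteHolonomy V p.1 p.2.1.1 p.2.1.2)
            ∂(Measure.pi fun _ : Edge d L => haarProbability G)) /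
          ((∫ V, ∏ p ∈ B, w (plaquetteHolonomy V p.1 p.2.1.1 p.2.1.2)
            ∂(Measure.pi fun _ : Edge d L => haarProbability G)) *
            ∏ p ∈ Finset.univ \ B, w (plaquetteHolonomy U p.1 p.2.1.1 p.2.1.2)))⁻¹) U).toReal ≤
        (M₂ / M) ^ S.card * (M ^ (Finset.univ \ B).card /
          ∏ p ∈ Finset.univ \ B, w (plaquetteHolonomy U p.1 p.2.1.1 p.2.1.2))) ∧
    ∀ θ : ℝ, 0 < θ → ∀ A : Set (GaugeConfig d L G), MeasurableSet A →
      (∀ U ∈ A, θ * M ^ (Finset.univ \ B).card <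
        ∏ p ∈ Finset.univ \ B, w (plaquetteHolonomy U p.1 p.2.1.1 p.2.1.2)) → 0 < π.real A →
      1 / (π.real A + (M₂ / M) ^ S.card / θ) - 1 / 2 ≤
        tauInt (fun n => autocov (indepMH q fun U =>
          ((∫ V, ∏ p : Plaquette d L, w (plaquetteHolonomy V p.1 p.2.1.1 p.2.1.2)
              ∂(Measure.pi fun _ : Edge d L => haarProbability G)) /
            ((∫ V, ∏ p ∈ B, w (plaquetteHolonomy V p.1 p.2.1.1 p.2.1.2)
              ∂(Measure.pi fun _ : Edge d L => haarProbability G)) *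
              ∏ p ∈ Finset.univ \ B, w (plaquetteHolonomy U p.1 p.2.1.1 p.2.1.2)))⁻¹) π
            (fun U => A.indicator (fun _ => (1 : ℝ)) U - π.real A) n /
          autocov (indepMH q fun U =>
          ((∫ V, ∏ p : Plaquette d L, w (plaquetteHolonomy V p.1 p.2.1.1 p.2.1.2)
              ∂(Measure.pi fun _ : Edge d L => haarProbability G)) /
            ((∫ V, ∏ p ∈ B, w (plaquetteHolonomy V p.1 p.2.1.1 p.2.1.2)
              ∂(Measure.pi fun _ : Edge d L => haarProbability G)) *
              ∏ p ∈ Finset.univ \ B, w (plaquetteHolonomy U p.1 p.2.1.1 p.2.1.2)))⁻¹) π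
            (fun U => A.indicator (fun _ => (1 : ℝ)) U - π.real A) 0) := by
  set Haar : Measure (GaugeConfig d L G) := Measure.pi fun _ : Edge d L => haarProbability G with hHaar
  set FT : GaugeConfig d L G → ℝ := fun U => ∏ p : Plaquette d L, w (plaquetteHolonomy U p.1 p.2.1.1 p.2.1.2)
    with hFT
  set FB : GaugeConfig d L G → ℝ := fun U => ∏ p ∈ B, w (plaquetteHolonomy U p.1 p.2.1.1 p.2.1.2) with hFB
  set FR : GaugeConfig d L G → ℝ := fun U => ∏ p ∈ Finset.univ \ B, w (plaquetteHolonomy U p.1 p.2.1.1 p.2.1.2)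
    with hFR
  set ZT : ℝ := ∫ V, FT V ∂Haar with hZT
  set ZB : ℝ := ∫ V, FB V ∂Haar with hZB
  set k : ℕ := (Finset.univ \ B).card with hk
  set s : ℕ := S.card with hs
  have hw0 : ∀ g, 0 < w g := fun g => hm0.trans_le (hm g)
  have hMpos : 0 < M := (hw0 1).trans_le (hM 1)
  haveI : IsProbabilityMeasure Haar := by rw [hHaar]; infer_instance
  have hc : 0 < ∫ g, w g ∂(haarProbability G) := haarProbability_integral_pos_of_continuous_pos hw hw0
  have hFTc : Continuous FT := continuous_prodPlaquetteWeight_anyDim hw Finset.univ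
  have hFRc : Continuous FR := continuous_prodPlaquetteWeight_anyDim hw (Finset.univ \ B)
  have hFTpos : ∀ U, 0 < FT U := fun U => prod_pos fun p _ => hw0 _
  have hFRpos : ∀ U, 0 < FR U := fun U => prod_pos fun p _ => hw0 _
  have hFRle : ∀ U, FR U ≤ M ^ k := fun U => (pow_le_prodPlaquetteWeight_le_pow_anyDim hm0 hm hM _ U).2
  have hFTi : Integrable FT Haar := by
    refine Integrable.mono' (integrable_const (M ^ (Finset.univ : Finset (Plaquette d L)).card))
      hFTc.aestronglyMeasurable (ae_of_all _ fun U => ?_)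
    rw [Real.norm_eq_abs, abs_of_pos (hFTpos U)]
    exact (pow_le_prodPlaquetteWeight_le_pow_anyDim hm0 hm hM _ U).2
  have hZTpos : 0 < ZT := by
    have h := integral_mono (integrable_const (m ^ (Finset.univ : Finset (Plaquette d L)).card)) hFTi
      fun U => (pow_le_prodPlaquetteWeight_le_pow_anyDim hm0 hm hM _ U).1
    rw [integral_const, smul_eq_mul, probReal_univ, one_mul] at h
    exact lt_of_lt_of_le (pow_pos hm0 _) h
  have hZB : ZB = (∫ g, w g ∂(haarProbability G)) ^ B.card :=
    integral_prod_weight_eq_pow_of_rank (G := G) hL hw hm0 hm hM B t ht rank hrank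
  have hZBpos : 0 < ZB := by rw [hZB]; exact pow_pos hc _
  -- the closing-section bound `Z/Z_B ≤ M^{k−s} M₂^s = (M₂/M)^s M^k`
  have hSsub : S ⊆ Finset.univ \ B := fun p' hp' => Finset.mem_sdiff.2 ⟨Finset.mem_univ _, hSB p' hp'⟩
  have hsk : s ≤ k := Finset.card_le_card hSsub
  have hdiv : ZT / ZB ≤ M ^ (k - s) * M₂ ^ s :=
    integral_prod_weight_div_le_of_closing (G := G) hL hw hm0 hm hM hM₂ hM₂' B t ht rank hrank S u hSB
      huB hut humax huinj
  have hM₂0 : 0 ≤ M₂ := by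
    have h1 := hM₂ 1 1
    have h0 : 0 ≤ ∫ h, w h * w (1 * h * 1) ∂(haarProbability G) :=
      integral_nonneg fun h => mul_nonneg (hw0 _).le (hw0 _).le
    exact (mul_nonneg_iff_of_pos_left hc).1 (h0.trans h1)
  have hpow : M ^ (k - s) * M₂ ^ s = (M₂ / M) ^ s * M ^ k := by
    have h1 : M ^ k = M ^ (k - s) * M ^ s := by rw [← pow_add, Nat.sub_add_cancel hsk]
    have hMs : M ^ s ≠ 0 := pow_ne_zero _ hMpos.ne'
    rw [h1, div_pow]
    field_simp
  -- the density ratio `ρ = Z/(Z_B F_R)` and the kernel weight `ρ⁻¹`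
  set ρ : GaugeConfig d L G → ℝ := fun U => ZT / (ZB * FR U) with hρ
  have hρpos : ∀ U, 0 < ρ U := fun U => div_pos hZTpos (mul_pos hZBpos (hFRpos U))
  have hρm : Measurable ρ := (continuous_const.div (continuous_const.mul hFRc)
    fun U => (mul_pos hZBpos (hFRpos U)).ne').measurable
  have hρle : ∀ U, ρ U ≤ (M₂ / M) ^ s * (M ^ k / FR U) := by
    intro U
    calc ρ U = (ZT / ZB) / FR U := by rw [hρ, div_div]
      _ ≤ (M ^ (k - s) * M₂ ^ s) / FR U := div_le_div_of_nonneg_right hdiv (hFRpos U).le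
      _ = (M₂ / M) ^ s * (M ^ k / FR U) := by rw [hpow, mul_div_assoc]
  have hsplit : ∀ U, FT U = FR U * FB U := fun U => (Finset.prod_sdiff (Finset.subset_univ B)).symm
  have hFBpos : ∀ U, 0 < FB U := fun U => prod_pos fun p _ => hw0 _
  have hρq : q = π.withDensity fun U => ENNReal.ofReal (ρ U) := by
    rw [hq, hπ]
    change Haar.withDensity (fun U => ENNReal.ofReal (FB U / ZB)) =
      (Haar.withDensity fun U => ENNReal.ofReal (FT U / ZT)).withDensity fun U => ENNReal.ofReal (ρ U)
    rw [← withDensity_mul _ (by fun_prop : Measurable fun U => ENNReal.ofReal (FT U / ZT))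
      (by exact hρm.ennreal_ofReal)]
    refine withDensity_congr_ae (ae_of_all _ fun U => ?_)
    simp only [Pi.mul_apply]
    rw [← ENNReal.ofReal_mul (div_nonneg (hFTpos U).le hZTpos.le)]
    congr 1
    rw [hρ, hsplit U]
    field_simp [(hFRpos U).ne', hZBpos.ne', hZTpos.ne']
  have hπ' : (q.withDensity fun U => ENNReal.ofReal (ρ U)⁻¹) = π := withDensity_inv_density hρm hρpos hρq
  have hwm : Measurable fun U => (ρ U)⁻¹ := hρm.inv
  have hw0' : ∀ U, 0 < (ρ U)⁻¹ := fun U => inv_pos.2 (hρpos U)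
  have hwb : ∀ U, |(ρ U)⁻¹| ≤ ZB * M ^ k / ZT := by
    intro U
    rw [abs_of_pos (hw0' U), hρ, inv_div]
    exact div_le_div_of_nonneg_right (mul_le_mul_of_nonneg_left (hFRle U) hZBpos.le) hZTpos.le
  have hwi : Integrable (fun U => (ρ U)⁻¹) q := integrable_of_bounded q hwm hwb
  -- (a) the acceptance mass from `U` is at most `ρ(U)`
  have hone : ∫⁻ y, ENNReal.ofReal (ρ y)⁻¹ ∂q = 1 := by
    have h : π Set.univ = 1 := measure_univ
    rw [← hπ', withDensity_apply _ MeasurableSet.univ, Measure.restrict_univ] at h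
    exact h
  have hacc : ∀ U, (imhAcceptMass q (fun U => (ρ U)⁻¹) U).toReal ≤ ρ U := by
    intro U
    have h := imhAcceptMass_le (q := q) hw0' U
    rw [hone, mul_one, inv_inv] at h
    have h2 := ENNReal.toReal_mono ENNReal.ofReal_ne_top h
    rwa [ENNReal.toReal_ofReal (hρpos U).le] at h2
  refine ⟨fun U => (hacc U).trans (hρle U), ?_⟩
  -- (b) the `τ_int` floor of a frozen event
  intro θ hθ A hA hAθ hApos
  have hMM : 0 ≤ (M₂ / M) ^ s := pow_nonneg (div_nonneg hM₂0 hMpos.le) _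
  have hηA : ∀ U ∈ A, (imhAcceptMass q (fun U => (ρ U)⁻¹) U).toReal ≤ (M₂ / M) ^ s / θ := by
    intro U hU
    have h' : θ * M ^ k < FR U := hAθ U hU
    have hfr : M ^ k / FR U ≤ 1 / θ := by
      rw [div_le_div_iff₀ (hFRpos U) hθ, one_mul]; linarith
    refine (hacc U).trans ((hρle U).trans ?_)
    calc (M₂ / M) ^ s * (M ^ k / FR U) ≤ (M₂ / M) ^ s * (1 / θ) := mul_le_mul_of_nonneg_left hfr hMM
      _ = (M₂ / M) ^ s / θ := mul_one_div _ _
  set g : GaugeConfig d L G → ℝ := fun U => A.indicator (fun _ => (1 : ℝ)) U - π.real A with hg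
  have hp1 : π.real A ≤ 1 := measureReal_le_one
  have hgm : Measurable g := (measurable_const.indicator hA).sub measurable_const
  have hgb : ∀ U, |g U| ≤ 1 := by
    intro U
    by_cases hU : U ∈ A
    · simp only [hg, Set.indicator_of_mem hU]
      rw [abs_le]; constructor <;> linarith [hApos.le, hp1]
    · simp only [hg, Set.indicator_of_notMem hU]
      rw [abs_le]; constructor <;> linarith [hApos.le, hp1]
  have hg0 : ∫ U, g U ∂π = 0 := by
    simp only [hg]
    rw [integral_sub ((integrable_const _).indicator hA) (integrable_const _),
      integral_indicator_const (1 : ℝ) hA, integral_const, smul_eq_mul, smul_eq_mul, mul_one,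
      probReal_univ, one_mul, sub_self]
  have hcov := (plaquetteBlockProposal_autocorrelation (G := G) hw hm0 hm hM B π q hπ hq hgm hgb hg0).1
  -- summability of the autocorrelation series (Doeblin envelope of the scorecard)
  have hsum : Summable fun n => autocov (indepMH q fun U => (ρ U)⁻¹) π g (n + 1) /
      autocov (indepMH q fun U => (ρ U)⁻¹) π g 0 := by
    by_cases hz : autocov (indepMH q fun U => (ρ U)⁻¹) π g 0 = 0
    · simp only [hz, div_zero]; exact summable_zero
    · have hC0 : 0 < autocov (indepMH q fun U => (ρ U)⁻¹) π g 0 := by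
        rw [autocov_zero] at hz ⊢
        exact lt_of_le_of_ne (integral_nonneg fun U => sq_nonneg _) (Ne.symm hz)
      have hr0 : 0 ≤ 1 - (m / M) ^ k := by
        have : (m / M) ^ k ≤ 1 := pow_le_one₀ (div_nonneg hm0.le hMpos.le)
          ((div_le_one hMpos).2 (by linarith [hm 1, hM 1]))
        linarith
      have hr1 : 1 - (m / M) ^ k < 1 := by
        have : 0 < (m / M) ^ k := pow_pos (div_pos hm0 hMpos) _
        linarith
      refine Summable.of_norm_bounded ((summable_geometric_of_lt_one hr0 hr1).mul_left (1 - (m / M) ^ k))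
        fun n => ?_
      rw [Real.norm_eq_abs, abs_div, abs_of_pos hC0, div_le_iff₀ hC0]
      have h := hcov (n + 1)
      rw [← autocov_zero] at h
      calc |autocov (indepMH q fun U => (ρ U)⁻¹) π g (n + 1)|
          ≤ (1 - (m / M) ^ k) ^ (n + 1) * autocov (indepMH q fun U => (ρ U)⁻¹) π g 0 := h
        _ = (1 - (m / M) ^ k) * (1 - (m / M) ^ k) ^ n *
              autocov (indepMH q fun U => (ρ U)⁻¹) π g 0 := by ring
  exact indepMH_event_tauInt_ge hwm hw0' hwi hπ' hA (div_nonneg hMM hθ.le) hηA hApos hsum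

end Summit.Ventures.LatticeQCDFlow.Theory2.Autoregressive

end
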